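import Summits.RiemannHypothesis.RiemannHypothesis.Theses.WeilComb
import Summits.RiemannHypothesis.RiemannHypothesis.Theorems.WeilCombCombShapePositivityArchOffdiagBounds
import Summits.RiemannHypothesis.RiemannHypothesis.Theorems.WeilCombCombShapePositivityStubSubOffdiag
import Literature.NumberTheory.LFunctions.WeilExplicit
import Literature.NumberTheory.LFunctions.WeilExplicitProofs
import Literature.NumberTheory.LFunctions.WeilMellinBounds
import Literature.NumberTheory.LFunctions.WeilWindowSimpleEven
import Mathlib.NumberTheory.Harmonic.Bounds

/-!
# Weighted Schur bound for the signed archimedean off-diagonal form of the fixed-shape comb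
(crux `WeilComb.CombShapePositivity`, item stmt-RiemannHypothesis-11229, line `Sketch`; stub
`stub_offdiagSchur` of the effective subcritical window `stub_windowSub40`)

Notation: `φ₀(u) = expNegInvGlue (1 - u²)`, `φ_ε(t) = ε⁻¹ φ₀(t/ε)`, `ψ_ε = φ_ε ⋆ φ̃_ε`,
`τ_x h = weilTranslate h x`, `W_∞ = weilArchTerm`, `g(t) = e^{t/2}/(2 sinh t)`, `I₀ = ∫ φ₀`,
`κ = (1 − (e^{4ε} − 1)M/2)⁻¹`. **Statement.** For `ε > 0`, `1 ≤ M`, `(e^{4ε} − 1) M < 2`,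
`2ε < log (1 + 1/M)` and every `a : ℕ → ℂ`:
`−I₀² e^ε κ (1 + log M) Σ_m m ‖a_m‖² ≤ Re Σ_m Σ_{m' ≠ m} a_m conj a_{m'} W_∞(τ_x ψ_ε)`,
`x = log m − log m'` (sums over `1 ≤ m, m' ≤ M`).

**Proof.** For `m ≠ m'` in `[1, M]`, `|x| ≥ log (1 + 1/M) > 2ε`;
`ψ_ε` is real and even, so `W_∞(τ_x ψ_ε) = W_∞(τ_{|x|} ψ_ε)` (`weilArchTerm_comp_neg`), which is
real and lies in `[−I₀² g(|x| − 2ε), 0]` (`weilArchTerm_translate_psi_offdiag_bounds`, p93560).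
So `Re (a_m conj a_{m'} W) ≥ −I₀² g(|x| − 2ε) ‖a_m‖ ‖a_{m'}‖`; the weighted AM–GM
`2 ‖a_m‖ ‖a_{m'}‖ ≤ ‖a_m‖² e^{x/2} + ‖a_{m'}‖² e^{−x/2}` (Perron weights `m^{-1/2}`) and the
symmetry `m ↔ m'` give `Re Off ≥ −I₀² Σ_m ‖a_m‖² R_m`, `R_m = Σ_{m' ≠ m} g(|x| − 2ε) e^{x/2}`.
Exact kernel algebra: with `t = |x| − 2ε`, `g(t) e^{t/2} = e^{2t}/(e^{2t} − 1)` and, for a pair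
`p < q`, `e^{2t} e^{4ε} p² = q²`; so `g(t) e^{±|x|/2} = e^ε q²/(q² − e^{4ε} p²) · {1, p/q}`, and
`q² − e^{4ε} p² ≥ κ⁻¹ (q² − p²)` (from `2p² ≤ M(q² − p²)`) plus partial fractions give
`g(|x| − 2ε) e^{x/2} ≤ e^ε κ (m/2)(1/|m − m'| + 1/(m + m'))`. Finally
`Σ_{m' ≠ m} (1/|m − m'| + 1/(m + m')) ≤ H_{M+m} + H_{M−m} ≤ 2 (1 + log M)` (the harmonic bound
`harmonic_le_one_add_log` through injections into `[1, M + m]` and `[1, M − m]`).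
-/

noncomputable section

-- the sub-problem path RiemannHypothesis/RiemannHypothesis duplicates a namespace (D-0017)
set_option linter.dupNamespace false

open scoped BigOperators ComplexConjugate
open Complex MeasureTheory

namespace Summit.RiemannHypothesis.RiemannHypothesis.Theorems.WeilCombBohrFejer

open Literature.NumberTheory.LFunctions

/-- For a real-valued `φ` and `ψ = φ ⋆ φ̃`: `W_∞(τ_x ψ) = W_∞(τ_{|x|} ψ)` — `ψ` is real and
self-adjoint (`conj_weilConv_weilReflect_neg`), hence even, so `τ_{−x} ψ = (τ_x ψ)(−·)`, and `W_∞`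
is reflection invariant (`weilArchTerm_comp_neg`). [folklore] -/
private theorem weilArchTerm_weilTranslate_abs_offdiagSchur {φ : ℝ → ℂ}
    (hreal : ∀ t, conj (φ t) = φ t) (x : ℝ) :
    weilArchTerm (weilTranslate (weilConv φ (weilReflect φ)) x) =
      weilArchTerm (weilTranslate (weilConv φ (weilReflect φ)) |x|) := by
  -- adapted from Theorems/WeilCombCombShapePositivityStubSubOffdiag.lean (private toolkit)
  rcases abs_choice x with hx | hx
  · rw [hx]
  have hconj : ∀ s, conj (weilConv φ (weilReflect φ) s) = weilConv φ (weilReflect φ) s := by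
    intro s
    rw [weilConv_apply, ← integral_conj]
    congr 1 with u
    simp only [weilReflect, map_mul, hreal]
  have heven : ∀ s, weilConv φ (weilReflect φ) (-s) = weilConv φ (weilReflect φ) s :=
    fun s => by rw [← hconj (-s)]; exact conj_weilConv_weilReflect_neg φ s
  have htr : weilTranslate (weilConv φ (weilReflect φ)) (-x) =
      fun t => weilTranslate (weilConv φ (weilReflect φ)) x (-t) := by
    funext t
    simp only [weilTranslate]
    rw [← heven (t - -x), show -(t - -x) = -t - x by ring]
  rw [hx, htr, weilArchTerm_comp_neg]

/-- The entry bound: for `w` real with `−I² g ≤ Re w ≤ −I² g' ≤ 0` and `‖z‖ = c c'`,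
`Re (z w) ≥ −I² g c c' ≥ −(I²/2)(c² g u + c'² g u⁻¹)` (weighted AM–GM, `u > 0`). [folklore] -/
private theorem entry_ge_offdiagSchur {z w : ℂ} {I g g' u c c' : ℝ} (him : w.im = 0)
    (hlo : -(I ^ 2 * g) ≤ w.re) (hhi : w.re ≤ -(I ^ 2 * g')) (hg : 0 ≤ g) (hg' : 0 ≤ g')
    (hu : 0 < u) (hz : ‖z‖ = c * c') :
    -(I ^ 2 / 2) * (c ^ 2 * (g * u)) + -(I ^ 2 / 2) * (c' ^ 2 * (g * u⁻¹)) ≤ (z * w).re := by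
  rw [Complex.mul_re, him, mul_zero, sub_zero]
  have h1 : |z.re| * |w.re| ≤ c * c' * (I ^ 2 * g) :=
    mul_le_mul (hz ▸ Complex.abs_re_le_norm z) (abs_le.2 ⟨hlo, by
      linarith [mul_nonneg (sq_nonneg I) hg, mul_nonneg (sq_nonneg I) hg']⟩) (abs_nonneg _)
      (hz ▸ norm_nonneg z)
  have h2 : 2 * c * c' ≤ c ^ 2 * u + c' ^ 2 * u⁻¹ := by
    rw [← sub_nonneg, show c ^ 2 * u + c' ^ 2 * u⁻¹ - 2 * c * c' = (c * u - c') ^ 2 / u by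
      field_simp; ring]
    positivity
  rw [← abs_mul] at h1
  nlinarith [neg_abs_le (z.re * w.re), mul_le_mul_of_nonneg_left h2 (mul_nonneg (sq_nonneg I) hg)]

/-- The exact kernel algebra `g(t) e^{t/2} = e^{2t}/(e^{2t} − 1)` for `t > 0`, where
`g(t) = e^{t/2}/(2 sinh t)` (multiply through by `e^t`: `2 sinh t · e^t = e^{2t} − 1`).
[folklore] -/
private theorem archWeight_mul_exp_half_offdiagSchur {t : ℝ} (ht : 0 < t) :
    Real.exp (t / 2) / (2 * Real.sinh t) * Real.exp (t / 2) =
      Real.exp (2 * t) / (Real.exp (2 * t) - 1) := by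
  have h2 : Real.exp t * Real.exp t = Real.exp (2 * t) := by rw [← Real.exp_add, two_mul]
  have h3 : Real.exp (-t) * Real.exp t = 1 := by
    rw [← Real.exp_add, neg_add_cancel, Real.exp_zero]
  have hs : 0 < 2 * Real.sinh t := mul_pos two_pos (Real.sinh_pos_iff.2 ht)
  have hden : 0 < Real.exp (2 * t) - 1 := sub_pos.2 (Real.one_lt_exp_iff.2 (by positivity))
  rw [div_mul_eq_mul_div, ← Real.exp_add, add_halves, div_eq_div_iff hs.ne' hden.ne',
    Real.sinh_eq, ← h2]
  linear_combination Real.exp t * h3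

/-- Perturbation: if `V · Q · p² = q²` with `1 ≤ p`, `p + 1 ≤ q ≤ M`, `1 ≤ Q`, `(Q − 1) M < 2`,
then `V/(V − 1) = q²/(q² − Q p²) ≤ (1 − (Q − 1)M/2)⁻¹ · q²/(q² − p²)`, because
`q² − Q p² − (1 − (Q − 1)M/2)(q² − p²) = (Q − 1)((M/2)(q² − p²) − p²) ≥ 0`. [folklore] -/
private theorem ratio_le_offdiagSchur {p q M Q V : ℝ} (hp : 1 ≤ p) (hpq : p + 1 ≤ q)
    (hqM : q ≤ M) (hQ : 1 ≤ Q) (hδ : (Q - 1) * M < 2) (hV : V * (Q * p ^ 2) = q ^ 2) :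
    V / (V - 1) ≤ (1 - (Q - 1) * M / 2)⁻¹ * (q ^ 2 / (q ^ 2 - p ^ 2)) := by
  have hp0 : 0 < p := by linarith
  have hM0 : 0 ≤ M := by linarith
  have hQp : 0 < Q * p ^ 2 := by positivity
  have hq2 : (p + 1) ^ 2 ≤ q ^ 2 := pow_le_pow_left₀ (by linarith) hpq 2
  have h1 : p ^ 2 ≤ M / 2 * (q ^ 2 - p ^ 2) := by
    nlinarith [mul_le_mul_of_nonneg_left (show p ≤ M by linarith) hp0.le]
  have h2 : 0 ≤ (Q - 1) * (M / 2 * (q ^ 2 - p ^ 2) - p ^ 2) :=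
    mul_nonneg (by linarith) (by linarith)
  have hkey : (q ^ 2 - p ^ 2) * (1 - (Q - 1) * M / 2) ≤ q ^ 2 - Q * p ^ 2 := by linarith [h2]
  have hden1 : 0 < 1 - (Q - 1) * M / 2 := by linarith
  have hgap : 0 < q ^ 2 - p ^ 2 := by nlinarith
  have hden2 : 0 < q ^ 2 - Q * p ^ 2 := lt_of_lt_of_le (mul_pos hgap hden1) hkey
  have hV1 : 0 < V - 1 := by
    rw [show V = q ^ 2 / (Q * p ^ 2) by rw [eq_div_iff hQp.ne']; exact hV, sub_pos,
      one_lt_div hQp]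
    linarith
  rw [show V / (V - 1) = q ^ 2 / (q ^ 2 - Q * p ^ 2) by
    rw [div_eq_div_iff hV1.ne' hden2.ne']; linear_combination (-1 : ℝ) * hV,
    inv_mul_eq_div, div_div]
  exact div_le_div_of_nonneg_left (sq_nonneg q) (mul_pos hgap hden1) hkey

/-- The two entry weights of a pair `1 ≤ p < q ≤ M` (`y = |log q − log p| = log q − log p`,
`t = y − 2ε > 0`, `κ = (1 − (e^{4ε} − 1)M/2)⁻¹`), stated with the absolute values of the
unordered kernel: the gap `2ε < y`, `g(t) e^{y/2} ≤ e^ε κ (q/2)(1/|q − p| + 1/(q + p))` and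
`g(t) e^{−y/2} ≤ e^ε κ (p/2)(1/|p − q| + 1/(p + q))` (`g(t) e^{y/2} = e^ε q²/(q² − e^{4ε} p²)`
as `e^{2t} e^{4ε} p² = q²`; then `ratio_le_offdiagSchur`, partial fractions, `e^{−y} = p/q`).
[folklore] -/
private theorem pair_weight_le_offdiagSchur {ε : ℝ} (hε : 0 < ε) {M p q : ℕ} (hp : 1 ≤ p)
    (hpq : p < q) (hqM : q ≤ M) (hδ : (Real.exp (4 * ε) - 1) * M < 2)
    (hgap : 2 * ε < Real.log (1 + 1 / (M : ℝ))) :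
    2 * ε < |Real.log q - Real.log p| ∧
    Real.exp ((|Real.log q - Real.log p| - 2 * ε) / 2) /
          (2 * Real.sinh (|Real.log q - Real.log p| - 2 * ε)) *
        Real.exp ((Real.log q - Real.log p) / 2) ≤
      Real.exp ε * (1 - (Real.exp (4 * ε) - 1) * M / 2)⁻¹ *
        ((q : ℝ) / 2 * (1 / |(q : ℝ) - p| + 1 / ((q : ℝ) + p))) ∧
    Real.exp ((|Real.log p - Real.log q| - 2 * ε) / 2) /
          (2 * Real.sinh (|Real.log p - Real.log q| - 2 * ε)) *
        Real.exp ((Real.log p - Real.log q) / 2) ≤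
      Real.exp ε * (1 - (Real.exp (4 * ε) - 1) * M / 2)⁻¹ *
        ((p : ℝ) / 2 * (1 / |(p : ℝ) - q| + 1 / ((p : ℝ) + q))) := by
  have hp1 : (1 : ℝ) ≤ p := by exact_mod_cast hp
  have hp0 : (0 : ℝ) < p := by linarith
  have hpq' : (p : ℝ) + 1 ≤ q := by exact_mod_cast hpq
  have hq0 : (0 : ℝ) < q := by linarith
  -- the pair is ordered: drop the absolute values
  rw [abs_sub_comm (Real.log (p : ℝ)) (Real.log q), abs_sub_comm (p : ℝ) q, add_comm (p : ℝ) q,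
    abs_of_pos (sub_pos.2 (Real.log_lt_log hp0 (by linarith))),
    abs_of_pos (sub_pos.2 (by linarith : (p : ℝ) < q))]
  have hqM' : (q : ℝ) ≤ M := by exact_mod_cast hqM
  have hM0 : (0 : ℝ) < M := by linarith
  set y : ℝ := Real.log q - Real.log p with hy
  have hexpy : Real.exp y = q / p := by rw [hy, Real.exp_sub, Real.exp_log hq0, Real.exp_log hp0]
  have hneg : Real.exp (-y) = p / q := by rw [Real.exp_neg, hexpy, inv_div]
  -- the log gap `y ≥ log (1 + 1/M) > 2ε`
  have hygap : 2 * ε < y := by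
    refine hgap.trans_le ?_
    rw [hy, ← Real.log_div hq0.ne' hp0.ne']
    refine Real.log_le_log (by positivity) ?_
    rw [le_div_iff₀ hp0, add_mul, one_mul, one_div_mul_eq_div]
    linarith [(div_le_one hM0).2 (show (p : ℝ) ≤ M by linarith)]
  set t : ℝ := y - 2 * ε with ht
  have ht0 : 0 < t := by rw [ht]; linarith
  -- `V = e^{2t}` satisfies `V e^{4ε} p² = q²`; partial fractions
  have hV : Real.exp (2 * t) * (Real.exp (4 * ε) * (p : ℝ) ^ 2) = (q : ℝ) ^ 2 := by
    rw [← mul_assoc, ← Real.exp_add, show 2 * t + 4 * ε = y + y by rw [ht]; ring,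
      Real.exp_add, hexpy]
    field_simp
  have hratio :=
    ratio_le_offdiagSchur hp1 hpq' hqM' (Real.one_le_exp (by positivity)) hδ hV
  have hpf : (q : ℝ) ^ 2 / ((q : ℝ) ^ 2 - p ^ 2) =
      q / 2 * (1 / ((q : ℝ) - p) + 1 / ((q : ℝ) + p)) := by
    have h1 : (q : ℝ) - p ≠ 0 := (sub_pos.2 (by linarith)).ne'
    have h2 : (q : ℝ) + p ≠ 0 := (add_pos hq0 hp0).ne'
    have h3 : (q : ℝ) ^ 2 - p ^ 2 ≠ 0 := by rw [sq_sub_sq]; exact mul_ne_zero h2 h1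
    field_simp
    ring
  rw [hpf] at hratio
  have hκ0 : 0 < (1 - (Real.exp (4 * ε) - 1) * M / 2)⁻¹ := inv_pos.2 (by linarith)
  -- above the diagonal `e^{y/2} = e^{t/2} e^ε`; below it `e^{-y/2} = e^{y/2} (p/q)`
  have ha : Real.exp (t / 2) / (2 * Real.sinh t) * Real.exp (y / 2) ≤
      Real.exp ε * (1 - (Real.exp (4 * ε) - 1) * M / 2)⁻¹ *
        ((q : ℝ) / 2 * (1 / ((q : ℝ) - p) + 1 / ((q : ℝ) + p))) := by
    rw [show Real.exp (y / 2) = Real.exp (t / 2) * Real.exp ε by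
      rw [← Real.exp_add, ht]; congr 1; ring, ← mul_assoc, archWeight_mul_exp_half_offdiagSchur ht0]
    nlinarith [mul_le_mul_of_nonneg_right hratio (Real.exp_pos ε).le]
  refine ⟨hygap, ha, ?_⟩
  rw [show Real.exp ((Real.log p - Real.log q) / 2) = Real.exp (y / 2) * (p / q) by
    rw [← hneg, ← Real.exp_add, hy]; congr 1; ring, ← mul_assoc]
  calc _ ≤ Real.exp ε * (1 - (Real.exp (4 * ε) - 1) * M / 2)⁻¹ *
          ((q : ℝ) / 2 * (1 / ((q : ℝ) - p) + 1 / ((q : ℝ) + p))) * (p / q) :=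
        mul_le_mul_of_nonneg_right ha (by positivity)
    _ = _ := by field_simp

/-- A map `e : s → {0, …, N}`, injective off `e = 0`, bounds `Σ_{x ∈ s} 1/e(x)` (with `1/0 = 0`)
by the harmonic sum `Σ_{k ≤ N} 1/k ≤ 1 + log N`. [folklore] -/
private theorem sum_one_div_le_log_offdiagSchur {α : Type*} {s : Finset α} {N : ℕ} (e : α → ℕ)
    (hinj : ∀ x ∈ s, ∀ y ∈ s, e x ≠ 0 → e x = e y → x = y) (hmaps : ∀ x ∈ s, e x ≤ N) :
    ∑ x ∈ s, 1 / ((e x : ℕ) : ℝ) ≤ 1 + Real.log N := by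
  -- adapted from Theorems/WeilCombCombShapePositivityStubSubArith.lean (`sum_one_div_le_log`)
  have hH := harmonic_le_one_add_log N
  simp_rw [harmonic_eq_sum_Icc, Rat.cast_sum, Rat.cast_inv, Rat.cast_natCast] at hH
  rw [← Finset.sum_filter_of_ne (p := fun x => e x ≠ 0)
    (fun x _ h h0 => h (by rw [h0, Nat.cast_zero, div_zero]))]
  have hinj' : Set.InjOn e ↑(s.filter fun x => e x ≠ 0) := by
    intro x hx y hy hxy
    simp only [Finset.coe_filter, Set.mem_setOf_eq] at hx hy
    exact hinj x hx.1 y hy.1 hx.2 hxy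
  calc ∑ x ∈ s.filter (fun x => e x ≠ 0), 1 / ((e x : ℕ) : ℝ)
      = ∑ k ∈ (s.filter fun x => e x ≠ 0).image e, 1 / (k : ℝ) :=
        (Finset.sum_image (f := fun k : ℕ => 1 / (k : ℝ)) hinj').symm
    _ ≤ ∑ k ∈ Finset.Icc 1 N, 1 / (k : ℝ) := by
        refine Finset.sum_le_sum_of_subset_of_nonneg (fun k hk => ?_) fun _ _ _ => by positivity
        simp only [Finset.mem_image, Finset.mem_filter] at hk
        obtain ⟨x, ⟨hx, hx0⟩, rfl⟩ := hk
        exact Finset.mem_Icc.mpr ⟨Nat.pos_of_ne_zero hx0, hmaps x hx⟩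
    _ ≤ 1 + Real.log N := by simpa only [one_div] using hH

/-- Row sums of the comparison kernel: for `m ∈ [1, M]`,
`Σ_{m' ≠ m} (1/|m − m'| + 1/(m + m')) ≤ 2 (1 + log M)`: the denominators `m − m'` (`m' < m`) and
`m + m'` are distinct in `[1, M + m]`, the `m' − m` (`m' > m`) lie in `[1, M − m]`, and
`log (M + m) + log (M − m) ≤ 2 log M` (for `m = M`: `log (2M) ≤ 1 + log M`). [folklore] -/
private theorem row_harmonic_le_offdiagSchur {m M : ℕ} (hm : m ∈ Finset.Icc 1 M) :
    ∑ m' ∈ (Finset.Icc 1 M).erase m, (1 / |(m : ℝ) - m'| + 1 / ((m : ℝ) + m')) ≤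
      2 * (1 + Real.log M) := by
  obtain ⟨hm1, hmM⟩ := Finset.mem_Icc.mp hm
  set S := (Finset.Icc 1 M).erase m with hS
  have hmemS : ∀ {x : ℕ}, x ∈ S → x ≠ m ∧ 1 ≤ x ∧ x ≤ M := fun hx => by
    simpa only [hS, Finset.mem_erase, Finset.mem_Icc] using hx
  have hM0 : (0 : ℝ) < M := by exact_mod_cast hm1.trans hmM
  have hlogM : 0 ≤ Real.log M := Real.log_nonneg (by exact_mod_cast hm1.trans hmM)
  -- `1/|m - m'| = 1/(m - m' : ℕ) + 1/(m' - m : ℕ)` (one of the two is `1/0 = 0`)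
  have hsplit : ∀ m' : ℕ, 1 / |(m : ℝ) - m'| + 1 / ((m : ℝ) + m') =
      (1 / ((m - m' : ℕ) : ℝ) + 1 / ((m + m' : ℕ) : ℝ)) + 1 / ((m' - m : ℕ) : ℝ) := by
    intro m'
    rw [Nat.cast_add]
    rcases le_or_gt m m' with h | h
    · rw [Nat.sub_eq_zero_of_le h, Nat.cast_zero, div_zero, zero_add, Nat.cast_sub h,
        abs_sub_comm, abs_of_nonneg (sub_nonneg.mpr (by exact_mod_cast h))]
      ring
    · rw [Nat.sub_eq_zero_of_le h.le, Nat.cast_zero, div_zero, add_zero, Nat.cast_sub h.le,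
        abs_of_nonneg (sub_nonneg.mpr (by exact_mod_cast h.le))]
  simp_rw [hsplit]
  rw [Finset.sum_add_distrib, Finset.sum_add_distrib]
  have h1 : ∑ m' ∈ S, 1 / ((m - m' : ℕ) : ℝ) + ∑ m' ∈ S, 1 / ((m + m' : ℕ) : ℝ) ≤
      1 + Real.log ((M + m : ℕ) : ℝ) := by
    have h := sum_one_div_le_log_offdiagSchur (s := S.disjSum S) (N := M + m)
      (Sum.elim (fun m' => m - m') (fun m' => m + m')) ?_ ?_
    · simpa only [Finset.sum_disjSum, Sum.elim_inl, Sum.elim_inr] using h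
    · rintro (x | x) hx (y | y) hy h0 hxy <;>
        simp only [Finset.inl_mem_disjSum, Finset.inr_mem_disjSum, Sum.elim_inl, Sum.elim_inr,
          Sum.inl.injEq, Sum.inr.injEq, reduceCtorEq] at * <;>
        · have := hmemS hx
          have := hmemS hy
          omega
    · rintro (x | x) hx <;>
        simp only [Finset.inl_mem_disjSum, Finset.inr_mem_disjSum, Sum.elim_inl,
          Sum.elim_inr] at * <;>
        · have := hmemS hx
          omega
  have h2 : ∑ m' ∈ S, 1 / ((m' - m : ℕ) : ℝ) ≤ 1 + Real.log ((M - m : ℕ) : ℝ) :=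
    sum_one_div_le_log_offdiagSchur (fun m' => m' - m) (fun x _ y _ h0 h => by omega)
      fun x hx => Nat.sub_le_sub_right (hmemS hx).2.2 m
  rcases eq_or_lt_of_le hmM with h | hlt
  · -- `m = M`: the second family vanishes and `log (2M) ≤ 1 + log M`
    have hC : ∑ m' ∈ S, 1 / ((m' - m : ℕ) : ℝ) = 0 := by
      refine Finset.sum_eq_zero fun x hx => ?_
      have := (hmemS hx).2.2
      rw [Nat.sub_eq_zero_of_le (by omega), Nat.cast_zero, div_zero]
    have hlog2 : Real.log ((M + m : ℕ) : ℝ) ≤ 1 + Real.log M := by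
      rw [h, Nat.cast_add, ← two_mul, Real.log_mul two_ne_zero hM0.ne']
      linarith [Real.log_le_sub_one_of_pos (two_pos : (0 : ℝ) < 2)]
    linarith [h1, hC, hlog2, hlogM]
  · -- `m < M`: `log (M + m) + log (M - m) ≤ 2 log M`
    have hlog : Real.log ((M + m : ℕ) : ℝ) + Real.log ((M - m : ℕ) : ℝ) ≤ 2 * Real.log M := by
      have hpos1 : (0 : ℝ) < ((M + m : ℕ) : ℝ) := by positivity
      have hpos2 : (0 : ℝ) < ((M - m : ℕ) : ℝ) := by exact_mod_cast Nat.sub_pos_of_lt hlt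
      rw [← Real.log_mul hpos1.ne' hpos2.ne', two_mul, ← Real.log_mul hM0.ne' hM0.ne']
      refine Real.log_le_log (mul_pos hpos1 hpos2) ?_
      rw [Nat.cast_add, Nat.cast_sub hlt.le]
      nlinarith
    linarith [h1, h2, hlog]

/-- **Stub S1 of the effective subcritical window `stub_windowSub40` — weighted Schur bound of the
signed archimedean off-diagonal form.** For `ε > 0`, `1 ≤ M`, `(e^{4ε} − 1) M < 2`,
`2ε < log (1 + 1/M)` and every `a : ℕ → ℂ`:
`−I₀² e^ε (1 − (e^{4ε} − 1)M/2)⁻¹ (1 + log M) Σ_m m ‖a_m‖² ≤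
  Re Σ_m Σ_{m' ≠ m} a_m conj a_{m'} W_∞(τ_{log m − log m'} ψ_ε)`
(Schur test with Perron weights `m^{-1/2}` and the exact kernel `e^{t/2}/(2 sinh t)`). -/
theorem stub_offdiagSchur : ∀ ε : ℝ, 0 < ε → ∀ (M : ℕ) (a : ℕ → ℂ), 1 ≤ M →
    (Real.exp (4 * ε) - 1) * M < 2 → 2 * ε < Real.log (1 + 1 / (M : ℝ)) →
    -((∫ u : ℝ, expNegInvGlue (1 - u ^ 2)) ^ 2 * Real.exp ε *
        (1 - (Real.exp (4 * ε) - 1) * M / 2)⁻¹ * (1 + Real.log M) *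
          ∑ m ∈ Finset.Icc 1 M, (m : ℝ) * ‖a m‖ ^ 2) ≤
      (∑ m ∈ Finset.Icc 1 M, ∑ m' ∈ (Finset.Icc 1 M).erase m,
        a m * conj (a m') *
          weilArchTerm (weilTranslate
            (weilConv (fun t : ℝ => (ε : ℂ)⁻¹ * ((expNegInvGlue (1 - (t / ε) ^ 2) : ℝ) : ℂ))
              (weilReflect (fun t : ℝ => (ε : ℂ)⁻¹ * ((expNegInvGlue (1 - (t / ε) ^ 2) : ℝ) : ℂ))))
            (Real.log (m : ℝ) - Real.log (m' : ℝ)))).re := by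
  intro ε hε M a hM hδ hgap
  set I0 : ℝ := ∫ u : ℝ, expNegInvGlue (1 - u ^ 2) with hI0
  set κ : ℝ := (1 - (Real.exp (4 * ε) - 1) * M / 2)⁻¹ with hκ
  set S := Finset.Icc 1 M with hS
  set ψ : ℝ → ℂ := weilConv (fun t : ℝ => (ε : ℂ)⁻¹ * ((expNegInvGlue (1 - (t / ε) ^ 2) : ℝ) : ℂ))
      (weilReflect (fun t : ℝ => (ε : ℂ)⁻¹ * ((expNegInvGlue (1 - (t / ε) ^ 2) : ℝ) : ℂ)))
    with hψ
  -- the Schur weight `F m m' = g(|x| − 2ε) e^{x/2}`, `x = log m − log m'`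
  set F : ℕ → ℕ → ℝ := fun m m' =>
    Real.exp ((|Real.log m - Real.log m'| - 2 * ε) / 2) /
        (2 * Real.sinh (|Real.log m - Real.log m'| - 2 * ε)) *
      Real.exp ((Real.log m - Real.log m') / 2) with hF
  have hκ0 : 0 < κ := inv_pos.2 (by linarith)
  have hφreal : ∀ t : ℝ, conj ((ε : ℂ)⁻¹ * ((expNegInvGlue (1 - (t / ε) ^ 2) : ℝ) : ℂ)) =
      (ε : ℂ)⁻¹ * ((expNegInvGlue (1 - (t / ε) ^ 2) : ℝ) : ℂ) := fun t => by
    simp only [map_mul, map_inv₀, Complex.conj_ofReal]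
  rw [Complex.re_sum]
  simp_rw [Complex.re_sum]
  -- Step 1: the log gap and the entry weight bound `F m m' ≤ e^ε κ (m/2)(1/|m-m'| + 1/(m+m'))`
  have hpair : ∀ m ∈ S, ∀ m' ∈ S.erase m, 2 * ε < |Real.log (m : ℝ) - Real.log m'| ∧
      F m m' ≤ Real.exp ε * κ * ((m : ℝ) / 2 * (1 / |(m : ℝ) - m'| + 1 / ((m : ℝ) + m'))) := by
    intro m hm m' hm'
    obtain ⟨hm1, hmM⟩ := Finset.mem_Icc.mp hm
    obtain ⟨hne, hm'S⟩ := Finset.mem_erase.mp hm'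
    obtain ⟨hm'1, hm'M⟩ := Finset.mem_Icc.mp hm'S
    simp only [hF]
    rcases lt_or_gt_of_ne hne with h | h
    · -- `m' < m`: the pair `p = m' < q = m`
      obtain ⟨hg, ha, -⟩ := pair_weight_le_offdiagSchur hε hm'1 h hmM hδ hgap
      exact ⟨hg, ha⟩
    · -- `m < m'`: the pair `p = m < q = m'`
      obtain ⟨hg, -, hb⟩ := pair_weight_le_offdiagSchur hε hm1 h hm'M hδ hgap
      exact ⟨by rwa [abs_sub_comm] at hg, hb⟩
  -- Step 2: row sums `Σ_{m' ≠ m} F m m' ≤ e^ε κ m (1 + log M)` (`row_harmonic_le_offdiagSchur`)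
  have hrow : ∀ m ∈ S, ‖a m‖ ^ 2 * ∑ m' ∈ S.erase m, F m m' ≤
      ‖a m‖ ^ 2 * (Real.exp ε * κ * ((m : ℝ) * (1 + Real.log M))) := by
    intro m hm
    refine mul_le_mul_of_nonneg_left ?_ (sq_nonneg _)
    have h := Finset.sum_le_sum fun m' hm' => (hpair m hm m' hm').2
    rw [← Finset.mul_sum, ← Finset.mul_sum] at h
    have hc : 0 ≤ Real.exp ε * κ * (m : ℝ) := by positivity
    nlinarith [h, mul_le_mul_of_nonneg_left (row_harmonic_le_offdiagSchur hm) hc]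
  -- Step 3: the entries `Re (a_m conj a_{m'} W) ≥ -(I₀²/2)(‖a_m‖² F m m' + ‖a_{m'}‖² F m' m)`
  have hentry : ∀ m ∈ S, ∀ m' ∈ S.erase m,
      -(I0 ^ 2 / 2) * (‖a m‖ ^ 2 * F m m') + -(I0 ^ 2 / 2) * (‖a m'‖ ^ 2 * F m' m) ≤
        (a m * conj (a m') *
          weilArchTerm (weilTranslate ψ (Real.log (m : ℝ) - Real.log (m' : ℝ)))).re := by
    intro m hm m' hm'
    have hgapx : 2 * ε < |Real.log (m : ℝ) - Real.log m'| := (hpair m hm m' hm').1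
    -- evenness reduces to `|x|`, where the bracket of p93560 applies
    obtain ⟨him, hlo, hhi⟩ := weilArchTerm_translate_psi_offdiag_bounds ε hε _ hgapx
    set g : ℝ := Real.exp ((|Real.log (m : ℝ) - Real.log m'| - 2 * ε) / 2) /
      (2 * Real.sinh (|Real.log (m : ℝ) - Real.log m'| - 2 * ε)) with hg
    -- `F m m' = g w`, `F m' m = g w⁻¹` with `w = e^{x/2}`
    have hF2 : F m' m = g * (Real.exp ((Real.log (m : ℝ) - Real.log m') / 2))⁻¹ := by
      simp only [hF, hg]
      rw [abs_sub_comm (Real.log (m' : ℝ)) (Real.log m), ← Real.exp_neg,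
        show (Real.log (m' : ℝ) - Real.log m) / 2 = -((Real.log (m : ℝ) - Real.log m') / 2) by
          ring]
    rw [hψ, weilArchTerm_weilTranslate_abs_offdiagSchur hφreal, hF2]
    exact entry_ge_offdiagSchur him hlo hhi
      (div_pos (Real.exp_pos _) (mul_pos two_pos (Real.sinh_pos_iff.2 (by linarith)))).le
      (div_pos (Real.exp_pos _) (mul_pos two_pos (Real.sinh_pos_iff.2 (by linarith)))).le
      (Real.exp_pos _) (by rw [norm_mul, Complex.norm_conj])
  -- Step 4: symmetry `m ↔ m'` of the ordered off-diagonal pairs, and assembly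
  have hsymm : ∑ m ∈ S, ∑ m' ∈ S.erase m, ‖a m'‖ ^ 2 * F m' m =
      ∑ m ∈ S, ∑ m' ∈ S.erase m, ‖a m‖ ^ 2 * F m m' := by
    rw [Finset.sum_comm' (t' := S) (s' := fun m' => S.erase m')]
    intro m m'
    simp only [Finset.mem_erase]
    exact ⟨fun ⟨h1, h2, h3⟩ => ⟨⟨fun h => h2 h.symm, h1⟩, h3⟩,
      fun ⟨⟨h1, h2⟩, h3⟩ => ⟨h2, fun h => h1 h.symm, h3⟩⟩
  have hsum' : ∑ m ∈ S, ‖a m‖ ^ 2 * (Real.exp ε * κ * ((m : ℝ) * (1 + Real.log M))) =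
      Real.exp ε * κ * (1 + Real.log M) * ∑ m ∈ S, (m : ℝ) * ‖a m‖ ^ 2 := by
    rw [Finset.mul_sum]
    exact Finset.sum_congr rfl fun m _ => by ring
  calc -(I0 ^ 2 * Real.exp ε * κ * (1 + Real.log M) * ∑ m ∈ S, (m : ℝ) * ‖a m‖ ^ 2)
      ≤ -(I0 ^ 2 * ∑ m ∈ S, ‖a m‖ ^ 2 * ∑ m' ∈ S.erase m, F m m') := by
        nlinarith [mul_le_mul_of_nonneg_left (Finset.sum_le_sum hrow) (sq_nonneg I0), hsum']
    _ = ∑ m ∈ S, ∑ m' ∈ S.erase m,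
          (-(I0 ^ 2 / 2) * (‖a m‖ ^ 2 * F m m') + -(I0 ^ 2 / 2) * (‖a m'‖ ^ 2 * F m' m)) := by
        simp only [Finset.sum_add_distrib, ← Finset.mul_sum, hsymm]
        ring
    _ ≤ _ := Finset.sum_le_sum fun m hm => Finset.sum_le_sum fun m' hm' => hentry m hm m' hm'

end Summit.RiemannHypothesis.RiemannHypothesis.Theorems.WeilCombBohrFejer

end
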